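import Mathlib
import HarnessLib.Audit
import Summits.PneNP.PneNP.Theorems.PstarGateCaseTPrivateCross
import Summits.PneNP.PneNP.Theorems.PstarGateBudgetCrosses

/-!
# One GATED chord, CASE T with `q_mv` NOT affine: two private `u`-avoiding edges on the gated cycle leave at most five outputs (E2 node N4X; prover-1 g20)

FRONTIER range-avoidance ladder, rung F-N3 (`stmt-PneNP-19007`), cell `pnp-ideate` (`PstarGateNodesX.GateCaseTQuadX`); restricted-model proof
complexity — nothing here bears on `P` versus `NP`.

The non-affine counterpart of `PstarGateOrFamilyCross.two_private_false`.  CASE T, another chord, `π ≠ ν` the only `u`-avoiding edges of `D e`,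
both private within `D e`, and `#J₀ ≥ 6`.  Every GLOBALLY private one of `π, ν` carries a cross gate (`PstarGateCaseTPrivateCross.caseT_private_cross`;
the other edge supplies the richness), the budget with the set `O` of these gates (`PstarGateBudgetCrosses.gate_budget_crosses`) has no private
tree edge left (a private tree edge lies on `D e` and avoids `u`, `private_mem_cycle_quad`, so it is `π` or `ν`, touched by its gate): `#F + 1 ≤ #N + #O`.
With `#N = 2` and `#O ≤ 2` this is `#J₀ ≤ 5`; with `#N = 3` the tree contains `π, ν` and the two distinct `u`-edges of the other chords, so `#O = 2`,
both `π, ν` are globally private — the residual returned to the caller (killed by `PstarGateCaseTQuadThree.caseT_quad_three_false`):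

* `caseT_two_private_quad` — **either impossible, or: two other chords and both `π, ν` globally private.**
-/

set_option linter.dupNamespace false -- `Summit.PneNP.PneNP.…`: summit = sub-problem name (D-0017 single-conjunct layout)

open Finset Module Literature.Computability.Complexity
open scoped symmDiff
open Summit.PneNP.PneNP.Theorems.PstarTyped (Typed)
open Summit.PneNP.PneNP.Theorems.PstarSALevel (varSet bdry BoundaryExpanding SimpleOverlap)
open Summit.PneNP.PneNP.Theorems.PstarGapLinearised (andPair andPair_subset_varSet)
open Summit.PneNP.PneNP.Theorems.PstarChordEndgameTools (mem_andPair_iff)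
open Summit.PneNP.PneNP.Theorems.PstarCentreFree (vars_mem_varSet)
open Summit.PneNP.PneNP.Theorems.PstarReadSumset (V2)
open Summit.PneNP.PneNP.Theorems.PstarChordSystem (ChordSystem)
open Summit.PneNP.PneNP.Theorems.PstarChordBridgeTools (privs coef xpdeg)
open Summit.PneNP.PneNP.Theorems.PstarChordBridge (BridgeData sys)
open Summit.PneNP.PneNP.Theorems.PstarChordBridgeBasis (qDir polarDir)
open Summit.PneNP.PneNP.Theorems.PstarChordBridgeFundamental (eq_of_fundamental_eq)
open Summit.PneNP.PneNP.Theorems.PstarNorCoreTools (not_mem_bdry_of_two)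
open Summit.PneNP.PneNP.Theorems.PstarGateBridge (GateHyp)
open Summit.PneNP.PneNP.Theorems.PstarGateNodes (GateData)
open Summit.PneNP.PneNP.Theorems.PstarGateNodesX (GateDataX)
open Summit.PneNP.PneNP.Theorems.PstarGateBudgetCrosses (gate_budget_crosses)
open Summit.PneNP.PneNP.Theorems.PstarGateCaseTStructure (caseT_diff_single caseT_card_others_le_two)
open Summit.PneNP.PneNP.Theorems.PstarGateCaseTPrivateCycleQuad (private_mem_cycle_quad)
open Summit.PneNP.PneNP.Theorems.PstarGateCaseTPrivateCross (caseT_private_cross)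

namespace Summit.PneNP.PneNP.Theorems.PstarGateCaseTQuadTwo

variable {n m : ℕ}

/-- **Two private avoiding edges on the gated cycle leave at most five outputs** (N4X).  See the module docstring. -/
theorem caseT_two_private_quad (I : LocalMap 4 n m) (hI : I.IsPure xorAndPred) (hT : Typed I) (hS : SimpleOverlap I) {r₀ : ℕ}
    (hB : BoundaryExpanding r₀ I) {B : BridgeData n m} {e g₀ : Fin m} {u : Fin n} {κ₀ : ZMod 2} (hD : GateDataX I r₀ B e g₀ u κ₀)
    {mv : V2} (hmvT : mv = (0, 1) ∨ mv = (1, 1))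
    (hP : ∀ e' ∈ B.N, e' ≠ e → ∀ a, ((sys I B).ρ e' a = 0 ∨ (sys I B).ρ e' a = mv) ∧ ((sys I B).ρ' e' a = 0 ∨ (sys I B).ρ' e' a = mv))
    (hread : ∀ e' ∈ B.N, e' ≠ e → ∀ a, (sys I B).ρ e' a ≠ 0 ∨ (sys I B).ρ' e' a ≠ 0) (hN : (B.N.erase e).Nonempty)
    {π ν : Fin m} (hπD : π ∈ B.D e) (hνD : ν ∈ B.D e) (hπν : π ≠ ν)
    (hπ2 : I.vars π 2 ≠ u) (hπ3 : I.vars π 3 ≠ u) (hν2 : I.vars ν 2 ≠ u) (hν3 : I.vars ν 3 ≠ u)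
    (honly : ∀ j ∈ B.D e, I.vars j 2 ≠ u → I.vars j 3 ≠ u → j = π ∨ j = ν) (h5 : 5 < B.J₀.card) :
    ∃ c₁ ∈ B.N.erase e, ∃ c₂ ∈ B.N.erase e, c₁ ≠ c₂ ∧
      (∀ j' ∈ insert g₀ B.J₀, j' ≠ π → I.vars π 2 ∉ varSet I j' ∧ I.vars π 3 ∉ varSet I j') ∧
      (∀ j' ∈ insert g₀ B.J₀, j' ≠ ν → I.vars ν 2 ∉ varSet I j' ∧ I.vars ν 3 ∉ varSet I j') := by
  classical
  obtain ⟨hXc, hW, hr, hd₁, hd₂, -, -, -, hG, hg₀, hgv, hju, -⟩ := id hD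
  have he : e ∈ B.N := hG.1
  have heJ : e ∈ B.J₀ := hW.hN he
  have heD : e ∉ B.D e := fun h => (mem_sdiff.1 (hW.hD e he h)).2 he
  have hDeF : B.D e ⊆ B.J₀ \ B.N := hW.hD e he
  have hDeJ : B.D e ⊆ B.J₀ := hDeF.trans sdiff_subset
  set F := B.J₀ \ B.N with hFdef
  have hJcard : B.J₀.card = F.card + B.N.card := by
    have h1 := card_sdiff_add_card_eq_card hW.hN
    rw [← hFdef] at h1
    omega
  have hN3 : B.N.card ≤ 3 := by
    have h := caseT_card_others_le_two I hI hT hS hB hD hmvT hP hread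
    rw [card_erase_of_mem he] at h
    omega
  -- the `u`-edges of the other chords: in `F`, injectively
  have chord_edge₀ : ∀ c ∈ B.N.erase e, ∃ k ∈ F, B.D e ∆ B.D c = {k} ∧ (I.vars k 2 = u ∨ I.vars k 3 = u) := by
    intro c hc
    obtain ⟨k, hk, hku, -⟩ := caseT_diff_single I hI hT hS hB hD hmvT hP hread (mem_of_mem_erase hc) (ne_of_mem_erase hc)
    have hkM : k ∈ B.D e ∆ B.D c := by rw [hk]; exact mem_singleton_self _
    have hkF : k ∈ F := by
      rcases Finset.mem_symmDiff.1 hkM with ⟨h, -⟩ | ⟨h, -⟩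
      · exact hDeF h
      · exact hW.hD c (mem_of_mem_erase hc) h
    exact ⟨k, hkF, hk, hku⟩
  have edge_inj : ∀ c₁ ∈ B.N.erase e, ∀ c₂ ∈ B.N.erase e, ∀ k, B.D e ∆ B.D c₁ = {k} → B.D e ∆ B.D c₂ = {k} → c₁ = c₂ := by
    intro c₁ hc₁ c₂ hc₂ k hM₁ hM₂
    by_contra hc12
    have hDD : B.D c₁ = B.D c₂ := by
      have h1 : B.D c₁ = B.D e ∆ {k} := by rw [← hM₁, ← symmDiff_assoc, symmDiff_self, bot_symmDiff]
      have h2 : B.D c₂ = B.D e ∆ {k} := by rw [← hM₂, ← symmDiff_assoc, symmDiff_self, bot_symmDiff]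
      rw [h1, h2]
    have hc₁N := mem_of_mem_erase hc₁
    have hc₂N := mem_of_mem_erase hc₂
    have hcD : c₁ ∉ B.D c₁ := fun h => (mem_sdiff.1 (hW.hD c₁ hc₁N h)).2 hc₁N
    have hc'D : c₂ ∉ B.D c₁ := fun h => (mem_sdiff.1 (hW.hD c₁ hc₁N h)).2 hc₂N
    have hev' : ∀ w, Even (xpdeg I (insert c₂ (B.D c₁)) w) := fun w => by rw [hDD]; exact hW.hDeven c₂ hc₂N w
    exact hc12 (eq_of_fundamental_eq I hI hS hcD hc'D (hW.hDeven c₁ hc₁N) hev')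
  -- global privacy
  let priv : Fin m → Prop := fun j => ∀ j' ∈ insert g₀ B.J₀, j' ≠ j → I.vars j 2 ∉ varSet I j' ∧ I.vars j 3 ∉ varSet I j'
  -- `u` is held inside `J₀`; `p = vars e 2` is held by no edge of `D e`
  obtain ⟨jᵤ, hjᵤF, hjᵤu⟩ := hju
  have hjᵤJ : jᵤ ∈ B.J₀ := (mem_sdiff.1 hjᵤF).1
  have hu_jᵤ : u ∈ varSet I jᵤ := by rcases hjᵤu with h | h <;> rw [h] <;> exact vars_mem_varSet I jᵤ _
  have hp_bdry : I.vars e 2 ∈ bdry I B.J₀ := (hW.hchord e he).1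
  have hp_not : ∀ j ∈ B.D e, I.vars e 2 ∉ andPair I j := by
    intro j hj hv
    have hje : j ≠ e := fun h' => heD (h' ▸ hj)
    exact not_mem_bdry_of_two I (hDeJ hj) heJ hje (andPair_subset_varSet I j hv) (vars_mem_varSet I e 2) hp_bdry
  have havoid : ∀ {j}, j = π ∨ j = ν → j ∈ B.D e ∧ I.vars j 2 ≠ u ∧ I.vars j 3 ≠ u := by
    rintro j (rfl | rfl)
    exacts [⟨hπD, hπ2, hπ3⟩, ⟨hνD, hν2, hν3⟩]
  -- a cross gate for every globally private one of `π, ν`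
  have hcross : ∀ {j k : Fin m}, (j = π ∨ j = ν) → (k = π ∨ k = ν) → k ≠ j → priv j →
      ∃ o ∈ B.G₁ ∪ B.G₂, o ≠ g₀ ∧ (I.vars j 2 ∈ varSet I o ∨ I.vars j 3 ∈ varSet I o) ∧
        (∃ j₂ ∈ B.J₀, I.vars o 2 ∈ varSet I j₂) ∧ (∃ j₃ ∈ B.J₀, I.vars o 3 ∈ varSet I j₃) := by
    intro j k hj hk hkj hprivj
    obtain ⟨hjD, hj2, hj3⟩ := havoid hj
    obtain ⟨hkD, hk2, hk3⟩ := havoid hk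
    obtain ⟨o, ho, halt⟩ := caseT_private_cross I hI hT hS hB hD hmvT hP hread hN hjD hj2 hj3 hprivj hkD hkj hk2 hk3
    have held : ∀ {v : Fin n}, (v = u ∨ ∃ j' ∈ (B.D e).erase j, v ∈ andPair I j') → ∃ j₂ ∈ B.J₀, v ∈ varSet I j₂ := by
      intro v hv
      rcases hv with rfl | ⟨j', hj', hv⟩
      · exact ⟨jᵤ, hjᵤJ, hu_jᵤ⟩
      · exact ⟨j', hDeJ (mem_of_mem_erase hj'), andPair_subset_varSet I j' hv⟩
    have hjJ : j ∈ B.J₀ := hDeJ hjD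
    have touch_of : ∀ {s : Fin 4}, I.vars o s ∈ andPair I j → 2 ≤ s.val →
        (I.vars j 2 ∈ varSet I o ∨ I.vars j 3 ∈ varSet I o) ∧ o ≠ g₀ := by
      intro s hs hs2
      have hvo : I.vars o s ∈ varSet I o := vars_mem_varSet I o s
      refine ⟨?_, fun hog => ?_⟩
      · rcases (mem_andPair_iff I j _).1 hs with h | h
        · exact Or.inl (h ▸ hvo)
        · exact Or.inr (h ▸ hvo)
      · subst hog
        have hsv : I.vars o s = I.vars e 2 ∨ I.vars o s = u := by
          have hs23 : s = 2 ∨ s = 3 := by rcases s with ⟨s, h4⟩; simp only [Fin.ext_iff]; simp only at hs2; omega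
          rcases hs23 with rfl | rfl
          · rcases hgv with ⟨h, -⟩ | ⟨h, -⟩
            · exact Or.inl h
            · exact Or.inr h
          · rcases hgv with ⟨-, h⟩ | ⟨-, h⟩
            · exact Or.inr h
            · exact Or.inl h
        rcases hsv with h | h
        · exact hp_not j hjD (h ▸ hs)
        · rw [h] at hs
          rcases (mem_andPair_iff I j u).1 hs with h' | h'
          · exact hj2 h'.symm
          · exact hj3 h'.symm
    rcases halt with ⟨h2, h3⟩ | ⟨h3, h2⟩
    · obtain ⟨ht, hog⟩ := touch_of h2 (by decide)
      exact ⟨o, ho, hog, ht, ⟨j, hjJ, andPair_subset_varSet I j h2⟩, held h3⟩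
    · obtain ⟨ht, hog⟩ := touch_of h3 (by decide)
      exact ⟨o, ho, hog, ht, held h2, ⟨j, hjJ, andPair_subset_varSet I j h3⟩⟩
  -- the budget with a set `O` of cross gates touching every globally private one of `π, ν`
  have key : ∀ (O : Finset (Fin m)) (t : ℕ), O ⊆ B.G₁ ∪ B.G₂ → g₀ ∉ O → O.card ≤ t →
      (∀ o ∈ O, (∃ j₂ ∈ B.J₀, I.vars o 2 ∈ varSet I j₂) ∧ (∃ j₃ ∈ B.J₀, I.vars o 3 ∈ varSet I j₃)) →
      (∀ j, (j = π ∨ j = ν) → priv j → ∃ o ∈ O, I.vars j 2 ∈ varSet I o ∨ I.vars j 3 ∈ varSet I o) → F.card + 1 ≤ B.N.card + t := by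
    intro O t hOG hOg hOt hold htouch
    have hOJ : Disjoint O B.J₀ := by
      rw [Finset.disjoint_left]
      intro o ho hoJ
      rcases mem_union.1 (hOG ho) with h | h
      · exact disjoint_left.1 hd₁ h hoJ
      · exact disjoint_left.1 hd₂ h hoJ
    obtain ⟨Pv', hPv'F, hPv'priv, hb⟩ := gate_budget_crosses I hB hD hOG hOJ hOg hold
    have hPv'0 : Pv' = ∅ := by
      rw [eq_empty_iff_forall_notMem]
      intro j hj
      have hprivX : priv j := fun j' hj' hne => hPv'priv j hj j' (mem_union_right _ hj') hne
      obtain ⟨hjD, hj2, hj3, -⟩ := private_mem_cycle_quad I hI hT hS hB hD hmvT hP hread hN (hPv'F hj) hprivX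
      obtain ⟨o, ho, hto⟩ := htouch j (honly j hjD hj2 hj3) hprivX
      have hoj : o ≠ j := fun h => Finset.disjoint_left.1 hOJ ho (h ▸ (mem_sdiff.1 (hPv'F hj)).1)
      have hp := hPv'priv j hj o (mem_union_left _ ho) hoj
      rcases hto with h | h
      · exact hp.1 h
      · exact hp.2 h
    rw [hPv'0, card_empty, mul_zero, add_zero] at hb
    change F.card + 1 ≤ _ at hb
    omega
  -- with at most one gate, `#F ≤ #N`: for `#N = 2` this contradicts `#J₀ ≥ 6`, for `#N = 3` the four tree edges `π, ν, k₁, k₂` do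
  have three_or_small : F.card + 1 ≤ B.N.card + 1 → False := by
    intro hb
    rcases Nat.lt_or_ge (B.N.erase e).card 2 with hlt | hge
    · rw [card_erase_of_mem he] at hlt
      omega
    · obtain ⟨c₁, hc₁, c₂, hc₂, hc12⟩ := one_lt_card.1 (show 1 < (B.N.erase e).card by omega)
      obtain ⟨k₁, hk₁F, hM₁, hk₁u⟩ := chord_edge₀ c₁ hc₁
      obtain ⟨k₂, hk₂F, hM₂, hk₂u⟩ := chord_edge₀ c₂ hc₂
      have hk12 : k₁ ≠ k₂ := fun h => hc12 (edge_inj c₁ hc₁ c₂ hc₂ k₁ hM₁ (h ▸ hM₂))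
      have hku : ∀ {k}, (I.vars k 2 = u ∨ I.vars k 3 = u) → k ≠ π ∧ k ≠ ν := by
        intro k hk
        constructor
        · rintro rfl; rcases hk with h | h; exacts [hπ2 h, hπ3 h]
        · rintro rfl; rcases hk with h | h; exacts [hν2 h, hν3 h]
      have hsub : ({π, ν, k₁, k₂} : Finset (Fin m)) ⊆ F := by
        intro j hj
        simp only [mem_insert, mem_singleton] at hj
        rcases hj with rfl | rfl | rfl | rfl
        exacts [hDeF hπD, hDeF hνD, hk₁F, hk₂F]
      have hc4 : ({π, ν, k₁, k₂} : Finset (Fin m)).card = 4 := by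
        rw [card_insert_of_notMem, card_insert_of_notMem, card_pair hk12]
        · rw [mem_insert, mem_singleton, not_or]; exact ⟨Ne.symm (hku hk₁u).2, Ne.symm (hku hk₂u).2⟩
        · simp only [mem_insert, mem_singleton, not_or]; exact ⟨hπν, Ne.symm (hku hk₁u).1, Ne.symm (hku hk₂u).1⟩
      have := card_le_card hsub
      rw [hc4] at this
      omega
  -- dispatch on which of `π, ν` is globally private
  by_cases hpπ' : priv π <;> by_cases hpν' : priv ν
  · rcases Nat.lt_or_ge (B.N.erase e).card 2 with hlt | hge
    · -- both private, `#N = 2`: two gates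
      exfalso
      obtain ⟨o₁, ho₁, ho₁g, ht₁, hold₁⟩ := hcross (Or.inl rfl) (Or.inr rfl) (Ne.symm hπν) hpπ'
      obtain ⟨o₂, ho₂, ho₂g, ht₂, hold₂⟩ := hcross (Or.inr rfl) (Or.inl rfl) hπν hpν'
      have h := key ({o₁, o₂} : Finset (Fin m)) 2 (insert_subset ho₁ (singleton_subset_iff.2 ho₂))
        (by rw [mem_insert, mem_singleton, not_or]; exact ⟨Ne.symm ho₁g, Ne.symm ho₂g⟩)
        ((card_insert_le _ _).trans (by rw [card_singleton]))
        (fun o ho => by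
          rw [mem_insert, mem_singleton] at ho
          rcases ho with rfl | rfl
          exacts [hold₁, hold₂])
        (fun j hj _ => by
          rcases hj with rfl | rfl
          · exact ⟨o₁, mem_insert_self _ _, ht₁⟩
          · exact ⟨o₂, mem_insert_of_mem (mem_singleton_self _), ht₂⟩)
      rw [card_erase_of_mem he] at hlt
      omega
    · -- both private, `#N = 3`: the residual
      obtain ⟨c₁, hc₁, c₂, hc₂, hc12⟩ := one_lt_card.1 (show 1 < (B.N.erase e).card by omega)
      exact ⟨c₁, hc₁, c₂, hc₂, hc12, hpπ', hpν'⟩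
  · exfalso
    obtain ⟨o₁, ho₁, ho₁g, ht₁, hold₁⟩ := hcross (Or.inl rfl) (Or.inr rfl) (Ne.symm hπν) hpπ'
    refine three_or_small (key ({o₁} : Finset (Fin m)) 1 (singleton_subset_iff.2 ho₁) (by rw [mem_singleton]; exact Ne.symm ho₁g)
      (by rw [card_singleton]) (fun o ho => by rw [mem_singleton] at ho; subst ho; exact hold₁) (fun j hj hpj => ?_))
    rcases hj with rfl | rfl
    · exact ⟨o₁, mem_singleton_self _, ht₁⟩
    · exact absurd hpj hpν'
  · exfalso
    obtain ⟨o₂, ho₂, ho₂g, ht₂, hold₂⟩ := hcross (Or.inr rfl) (Or.inl rfl) hπν hpν'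
    refine three_or_small (key ({o₂} : Finset (Fin m)) 1 (singleton_subset_iff.2 ho₂) (by rw [mem_singleton]; exact Ne.symm ho₂g)
      (by rw [card_singleton]) (fun o ho => by rw [mem_singleton] at ho; subst ho; exact hold₂) (fun j hj hpj => ?_))
    rcases hj with rfl | rfl
    · exact absurd hpj hpπ'
    · exact ⟨o₂, mem_singleton_self _, ht₂⟩
  · exfalso
    have h := key (∅ : Finset (Fin m)) 0 (empty_subset _) (notMem_empty _) (by rw [card_empty])
      (fun o ho => absurd ho (notMem_empty _)) (fun j hj hpj => by
        rcases hj with rfl | rfl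
        · exact absurd hpj hpπ'
        · exact absurd hpj hpν')
    exact three_or_small (by omega)

end Summit.PneNP.PneNP.Theorems.PstarGateCaseTQuadTwo
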